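import Summits.Parity.GeneralizedHardyLittlewood.Theses.MaynardProductExact
import Literature.NumberTheory.Sieve.MaynardProductKernelCert3750Lit
import Literature.NumberTheory.Sieve.MaynardProductKernelCert3750Table

/-! # Route `MaynardProductExact` — crux `NumLB3749` (stmt-Parity-19245): kernel slice facts 4–7 (literal log table)

Helper for `Theorems/MaynardProductExactNumLB3749.lean`: literal lower bounds `L_s ≤ NUMSUMSL TLIT s` for the slices
`s ∈ {4, 5, 6, 7}` of the `k = 3750` numerator kernel certificate (`…ProductKernelCert3750.FactSlL`), each by `decide +kernel` in its own
declaration (packed initial vector + 15 convolution products + one 2^16-slot slice read with the certified literal weight table `TLIT`; literals = exact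
slice sums of the prover's GMP mirror minus `2^150`).  No summit is proved by this file. -/

open Literature.NumberTheory.Sieve.MaynardTao.ProductKernelCert3750

namespace Summit.Parity.GeneralizedHardyLittlewood.MaynardProductExactNumLB3749

set_option maxHeartbeats 0 in
/-- kernel slice fact 4: `L_4 ≤ NUMSUMSL TLIT 4`. -/
theorem okSl4 : FactSlL TLIT 4 2169407815381707424124416892535072055231290502243258173363397455 = true := by decide +kernel
set_option maxHeartbeats 0 in
/-- kernel slice fact 5: `L_5 ≤ NUMSUMSL TLIT 5`. -/
theorem okSl5 : FactSlL TLIT 5 2791181304074851417406877824547125030940714193101287486263720735 = true := by decide +kernel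
set_option maxHeartbeats 0 in
/-- kernel slice fact 6: `L_6 ≤ NUMSUMSL TLIT 6`. -/
theorem okSl6 : FactSlL TLIT 6 2741152490876019191678786206347630533059497024527226121839144134 = true := by decide +kernel
set_option maxHeartbeats 0 in
/-- kernel slice fact 7: `L_7 ≤ NUMSUMSL TLIT 7`. -/
theorem okSl7 : FactSlL TLIT 7 1815531870551499835547916166847022961381536289598888714236566336 = true := by decide +kernel

end Summit.Parity.GeneralizedHardyLittlewood.MaynardProductExactNumLB3749
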